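import Summits.KontsevichZagierPeriods.KontsevichZagierPeriods.Theorems.UnfoldedStokesStokesGenerationFibrewiseRungScaling

/-!
# `StokesGeneration` (stmt-KontsevichZagierPeriods-3586), line `fibrewise_stokes` — rung 13: rule (2) for fibrewise
# one-coordinate reparametrisations, in any dimension

Crux `Summit.KontsevichZagierPeriods.KontsevichZagierPeriods.Theses.UnfoldedStokes.StokesGeneration`; residual stub S2
`stub_fibrewiseStokesGeneration` (`FibStokesDecomposable`, `Theorems/UnfoldedStokesDefs.lean`). For an integrand `f` and a new
coordinate `ψ` on `[0,1]^N`, both `ℚ`-semialgebraic, continuous and `C¹` along the coordinate `a` (open fibres), with `ψ`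
fixing the two `a`-faces (`ψ = 0` on `{x_a = 0}`, `ψ = 1` on `{x_a = 1}`, `0 < ψ < 1` between), the change-of-variables
relator `f(x) − f(x[a ↦ ψ(x)]) · ∂ₐψ(x)` of the fibrewise map `Ψ : x ↦ x[a ↦ ψ(x)]` is fibrewise-Stokes decomposable
(`fibStokesDecomposable_sub_reparam`; core form with an explicit idle coordinate `fibStokesDecomposable_reparamCore`): the
straight-line homotopy `ψ_y = (1 − y)x_a + yψ` in an idle coordinate `y` and the ONE-dimensional transport identity
`∂_y[f(x[a ↦ ψ_y]) ∂ₐψ_y] = ∂ₐ[f(x[a ↦ ψ_y]) ∂_yψ_y]` give two elements — no Jacobian determinants, no transcendence input,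
no value hypothesis (and `Ψ` need not be injective). This is the `N`-dimensional parametric form of rung 2′ (lead c4,
endpoint-fixing reparametrisations of the interval); with rung 12 (permutations, reflections) it derives Kontsevich–Zagier's
rule (2) on the closed cube, from the fibrewise rule (3) alone, for every composition of triangular (one coordinate at a
time) semialgebraic `C¹` reparametrisations and hyperoctahedral symmetries.

References: M. Kontsevich, D. Zagier, *Periods* (2001), §1.2 rules (2), (3).
-/

noncomputable section

set_option linter.dupNamespace false

namespace Summit.KontsevichZagierPeriods.KontsevichZagierPeriods.Cruxes.StokesGeneration.FibrewiseStokes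

open MeasureTheory Set
open Literature.NumberTheory.Transcendental
open Literature.NumberTheory.Transcendental.KZ
open Literature.ModelTheory.ExponentialFields (IsSemialgebraic)

/-- **Rule (2) for a fibrewise reparametrisation of one coordinate (core form, lead c5).** On the closed unit cube
`[0,1]^N` let `f` (the integrand) and `ψ` (the new coordinate) be `ℚ`-semialgebraic and continuous, independent of an idle
coordinate `b`, and `C¹` along the coordinate `a ≠ b` with `ℚ`-semialgebraic continuous fibre derivatives `fₐ`, `ψₐ`;
suppose `ψ = 0` on the face `x_a = 0`, `ψ = 1` on the face `x_a = 1` and `0 < ψ < 1` in between. Then the change-of-variables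
relator of the fibrewise map `Ψ(x) = x[a ↦ ψ(x)]`, namely `f(x) − f(Ψ(x)) · ψₐ(x)`, is fibrewise-Stokes decomposable with TWO
elements on the same cube: the straight-line homotopy `ψ_y = (1 − y) x_a + y ψ` in the idle coordinate `y = x_b`,
`G₀ = f(x[a ↦ ψ_y]) ∂ₐψ_y` along `b` and `G₁ = −f(x[a ↦ ψ_y]) (ψ − x_a)` along `a` (the one-dimensional transport identity
with parameters; no Jacobian determinants, no transcendence input, no value hypothesis, `Ψ` need not be injective).
[cite: KontsevichZagier2001, §1.2 rules (2), (3)] -/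
theorem fibStokesDecomposable_reparamCore {N : ℕ} (a b : Fin N) (hab : a ≠ b) (f fₐ ψ ψₐ : (Fin N → ℝ) → ℝ)
    (hf : IsSemialgebraicFunOn ℚ (Set.pi Set.univ (fun _ : Fin N => Set.Icc (0:ℝ) 1)) f)
    (hfₐ : IsSemialgebraicFunOn ℚ (Set.pi Set.univ (fun _ : Fin N => Set.Icc (0:ℝ) 1)) fₐ)
    (hψ : IsSemialgebraicFunOn ℚ (Set.pi Set.univ (fun _ : Fin N => Set.Icc (0:ℝ) 1)) ψ)
    (hψₐ : IsSemialgebraicFunOn ℚ (Set.pi Set.univ (fun _ : Fin N => Set.Icc (0:ℝ) 1)) ψₐ)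
    (hfc : ContinuousOn f (Set.pi Set.univ (fun _ : Fin N => Set.Icc (0:ℝ) 1)))
    (hfₐc : ContinuousOn fₐ (Set.pi Set.univ (fun _ : Fin N => Set.Icc (0:ℝ) 1)))
    (hψc : ContinuousOn ψ (Set.pi Set.univ (fun _ : Fin N => Set.Icc (0:ℝ) 1)))
    (hψₐc : ContinuousOn ψₐ (Set.pi Set.univ (fun _ : Fin N => Set.Icc (0:ℝ) 1)))
    (hfb : ∀ x s, f (Function.update x b s) = f x)
    (hψb : ∀ x s, ψ (Function.update x b s) = ψ x) (hψₐb : ∀ x s, ψₐ (Function.update x b s) = ψₐ x)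
    (hfd : ∀ x ∈ Set.pi Set.univ (fun _ : Fin N => Set.Icc (0:ℝ) 1), x a ∈ Set.Ioo (0:ℝ) 1 →
      HasDerivAt (fun s => f (Function.update x a s)) (fₐ x) (x a))
    (hψd : ∀ x ∈ Set.pi Set.univ (fun _ : Fin N => Set.Icc (0:ℝ) 1), x a ∈ Set.Ioo (0:ℝ) 1 →
      HasDerivAt (fun s => ψ (Function.update x a s)) (ψₐ x) (x a))
    (hψ0 : ∀ x ∈ Set.pi Set.univ (fun _ : Fin N => Set.Icc (0:ℝ) 1), x a = 0 → ψ x = 0)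
    (hψ1 : ∀ x ∈ Set.pi Set.univ (fun _ : Fin N => Set.Icc (0:ℝ) 1), x a = 1 → ψ x = 1)
    (hψIoo : ∀ x ∈ Set.pi Set.univ (fun _ : Fin N => Set.Icc (0:ℝ) 1), x a ∈ Set.Ioo (0:ℝ) 1 →
      ψ x ∈ Set.Ioo (0:ℝ) 1) :
    FibStokesDecomposable N (fun x => f x - f (Function.update x a (ψ x)) * ψₐ x) := by
  classical
  set C : Set (Fin N → ℝ) := Set.pi Set.univ (fun _ : Fin N => Set.Icc (0:ℝ) 1) with hC
  have hCsa : IsSemialgebraic ℚ C := by rw [hC, ← cube_eq_pi]; exact isSemialgebraic_cube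
  have hCc : IsCompact C := isCompact_univ_pi fun _ => isCompact_Icc
  have hmem : ∀ x ∈ C, ∀ i, x i ∈ Set.Icc (0:ℝ) 1 := fun x hx i => (Set.mem_univ_pi.mp hx) i
  have hupd : ∀ x ∈ C, ∀ (i : Fin N), ∀ s ∈ Set.Icc (0:ℝ) 1, Function.update x i s ∈ C :=
    fun x hx i s hs => update_mem_cubePi hx i hs
  have hba : b ≠ a := fun h' => hab h'.symm
  have h0I : (0:ℝ) ∈ Set.Icc (0:ℝ) 1 := ⟨le_rfl, zero_le_one⟩
  have h1I : (1:ℝ) ∈ Set.Icc (0:ℝ) 1 := ⟨zero_le_one, le_rfl⟩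
  -- `ψ` takes values in `[0,1]`
  have hψI : ∀ x ∈ C, ψ x ∈ Set.Icc (0:ℝ) 1 := by
    intro x hx
    rcases (hmem x hx a).1.eq_or_lt with h0 | hpos
    · rw [hψ0 x hx h0.symm]; exact h0I
    rcases (hmem x hx a).2.eq_or_lt with h1 | hlt1
    · rw [hψ1 x hx h1]; exact h1I
    · exact Set.Ioo_subset_Icc_self (hψIoo x hx ⟨hpos, hlt1⟩)
  -- the fibre derivatives at an arbitrary interior height
  have hHf : ∀ x ∈ C, ∀ u₀ ∈ Set.Ioo (0:ℝ) 1,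
      HasDerivAt (fun u => f (Function.update x a u)) (fₐ (Function.update x a u₀)) u₀ := by
    intro x hx u₀ hu₀
    have := hfd _ (hupd x hx a u₀ (Set.Ioo_subset_Icc_self hu₀)) (by simpa using hu₀)
    simpa [Function.update_idem] using this
  -- the homotopy `u = (1 - x_b) x_a + x_b ψ`, its `a`-derivative `w`, the moved point `P x = x[a ↦ u x]`
  obtain ⟨u, hu⟩ : ∃ u : (Fin N → ℝ) → ℝ, u = fun x => (1 - x b) * x a + x b * ψ x := ⟨_, rfl⟩
  obtain ⟨w, hw⟩ : ∃ w : (Fin N → ℝ) → ℝ, w = fun x => (1 - x b) + x b * ψₐ x := ⟨_, rfl⟩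
  have huI : ∀ x ∈ C, u x ∈ Set.Icc (0:ℝ) 1 := by
    intro x hx
    have hxa := hmem x hx a; have hxb := hmem x hx b; have hψx := hψI x hx
    rw [hu]
    have h1 : 0 ≤ (1 - x b) * x a := mul_nonneg (sub_nonneg.2 hxb.2) hxa.1
    have h2 : 0 ≤ x b * ψ x := mul_nonneg hxb.1 hψx.1
    have h3 : (1 - x b) * x a ≤ 1 - x b := mul_le_of_le_one_right (sub_nonneg.2 hxb.2) hxa.2
    have h4 : x b * ψ x ≤ x b := mul_le_of_le_one_right hxb.1 hψx.2
    exact ⟨by linarith, by linarith⟩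
  have huIoo : ∀ x ∈ C, x a ∈ Set.Ioo (0:ℝ) 1 → u x ∈ Set.Ioo (0:ℝ) 1 := by
    intro x hx hxa
    have hxb := hmem x hx b; have hψx := hψIoo x hx hxa
    rw [hu]
    have hm : 0 < min (x a) (ψ x) := lt_min hxa.1 hψx.1
    have hM : max (x a) (ψ x) < 1 := max_lt hxa.2 hψx.2
    have h1 : 0 ≤ (1 - x b) * (x a - min (x a) (ψ x)) := mul_nonneg (sub_nonneg.2 hxb.2) (sub_nonneg.2 (min_le_left _ _))
    have h2 : 0 ≤ x b * (ψ x - min (x a) (ψ x)) := mul_nonneg hxb.1 (sub_nonneg.2 (min_le_right _ _))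
    have h3 : 0 ≤ (1 - x b) * (max (x a) (ψ x) - x a) := mul_nonneg (sub_nonneg.2 hxb.2) (sub_nonneg.2 (le_max_left _ _))
    have h4 : 0 ≤ x b * (max (x a) (ψ x) - ψ x) := mul_nonneg hxb.1 (sub_nonneg.2 (le_max_right _ _))
    exact ⟨by nlinarith, by nlinarith⟩
  obtain ⟨P, hP⟩ : ∃ P : (Fin N → ℝ) → (Fin N → ℝ), P = fun x => Function.update x a (u x) := ⟨_, rfl⟩
  have hPC : ∀ x ∈ C, P x ∈ C := fun x hx => by rw [hP]; exact hupd x hx a _ (huI x hx)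
  -- semialgebraic atoms
  have hxa : IsSemialgebraicFunOn ℚ C (fun x => x a) := isSemialgebraicFunOn_apply hCsa a
  have hxb : IsSemialgebraicFunOn ℚ C (fun x => x b) := isSemialgebraicFunOn_apply hCsa b
  have h1sa : IsSemialgebraicFunOn ℚ C (fun _ => (1:ℝ)) := isSemialgebraicFunOn_const_of_isAlgebraic hCsa isAlgebraic_one
  have husa : IsSemialgebraicFunOn ℚ C u := by rw [hu]; exact ((h1sa.fun_sub hxb).fun_mul hxa).fun_add (hxb.fun_mul hψ)
  have hwsa : IsSemialgebraicFunOn ℚ C w := by rw [hw]; exact (h1sa.fun_sub hxb).fun_add (hxb.fun_mul hψₐ)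
  have huc : ContinuousOn u C := by
    rw [hu]
    exact ((continuousOn_const.sub (continuous_apply b).continuousOn).mul (continuous_apply a).continuousOn).add
      ((continuous_apply b).continuousOn.mul hψc)
  have hwc : ContinuousOn w C := by
    rw [hw]
    exact (continuousOn_const.sub (continuous_apply b).continuousOn).add ((continuous_apply b).continuousOn.mul hψₐc)
  have hP_sa : IsSemialgebraicMapOn ℚ C P := by
    refine IsSemialgebraicMapOn.of_forall hCsa fun j => ?_
    rcases eq_or_ne j a with rfl | hja
    · exact husa.congr fun x _ => by simp [hP]
    · exact (isSemialgebraicFunOn_apply hCsa j).congr fun x _ => by simp [hP, Function.update_of_ne hja]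
  have hP_c : ContinuousOn P C := by
    refine continuousOn_pi' fun j => ?_
    rcases eq_or_ne j a with rfl | hja
    · exact huc.congr fun x _ => by simp [hP]
    · exact (continuous_apply j).continuousOn.congr fun x _ => by simp [hP, Function.update_of_ne hja]
  have hfP : IsSemialgebraicFunOn ℚ C (fun x => f (P x)) := IsSemialgebraicFunOn.comp_isSemialgebraicMapOn_holds hf hP_sa hPC
  have hfₐP : IsSemialgebraicFunOn ℚ C (fun x => fₐ (P x)) := IsSemialgebraicFunOn.comp_isSemialgebraicMapOn_holds hfₐ hP_sa hPC
  have hfPc : ContinuousOn (fun x => f (P x)) C := hfc.comp hP_c hPC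
  have hfₐPc : ContinuousOn (fun x => fₐ (P x)) C := hfₐc.comp hP_c hPC
  -- the witnesses
  obtain ⟨G0, hG0⟩ : ∃ G0 : (Fin N → ℝ) → ℝ, G0 = fun x => f (P x) * w x := ⟨_, rfl⟩
  obtain ⟨D0, hD0⟩ : ∃ D0 : (Fin N → ℝ) → ℝ, D0 = fun x =>
      fₐ (P x) * (ψ x - x a) * w x + f (P x) * (ψₐ x - 1) := ⟨_, rfl⟩
  obtain ⟨G1, hG1⟩ : ∃ G1 : (Fin N → ℝ) → ℝ, G1 = fun x => -(f (P x) * (ψ x - x a)) := ⟨_, rfl⟩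
  obtain ⟨D1, hD1⟩ : ∃ D1 : (Fin N → ℝ) → ℝ, D1 = fun x =>
      -(fₐ (P x) * w x * (ψ x - x a) + f (P x) * (ψₐ x - 1)) := ⟨_, rfl⟩
  have hG0sa : IsSemialgebraicFunOn ℚ C G0 := by rw [hG0]; exact hfP.fun_mul hwsa
  have hD0sa : IsSemialgebraicFunOn ℚ C D0 := by
    rw [hD0]; exact ((hfₐP.fun_mul (hψ.fun_sub hxa)).fun_mul hwsa).fun_add (hfP.fun_mul (hψₐ.fun_sub h1sa))
  have hG1sa : IsSemialgebraicFunOn ℚ C G1 := by rw [hG1]; exact (hfP.fun_mul (hψ.fun_sub hxa)).fun_neg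
  have hD1sa : IsSemialgebraicFunOn ℚ C D1 := by
    rw [hD1]; exact (((hfₐP.fun_mul hwsa).fun_mul (hψ.fun_sub hxa)).fun_add (hfP.fun_mul (hψₐ.fun_sub h1sa))).fun_neg
  have hG0c : ContinuousOn G0 C := by rw [hG0]; exact hfPc.mul hwc
  have hD0c : ContinuousOn D0 C := by
    rw [hD0]
    exact ((hfₐPc.mul (hψc.sub (continuous_apply a).continuousOn)).mul hwc).add (hfPc.mul (hψₐc.sub continuousOn_const))
  have hG1c : ContinuousOn G1 C := by rw [hG1]; exact (hfPc.mul (hψc.sub (continuous_apply a).continuousOn)).neg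
  have hD1c : ContinuousOn D1 C := by
    rw [hD1]
    exact (((hfₐPc.mul hwc).mul (hψc.sub (continuous_apply a).continuousOn)).add
      (hfPc.mul (hψₐc.sub continuousOn_const))).neg
  -- face maps
  have hface_sa : ∀ {F : (Fin N → ℝ) → ℝ}, IsSemialgebraicFunOn ℚ C F → ∀ (i : Fin N) (t : ℝ), IsAlgebraic ℚ t →
      t ∈ Set.Icc (0:ℝ) 1 → IsSemialgebraicFunOn ℚ C (fun x => F (Function.update x i t)) :=
    fun hF i t ht htI => IsSemialgebraicFunOn.comp_isSemialgebraicMapOn_holds hF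
      (isSemialgebraicMapOn_update_const i ht) fun x hx => hupd x hx i t htI
  have hface_c : ∀ {F : (Fin N → ℝ) → ℝ}, ContinuousOn F C → ∀ (i : Fin N) (t : ℝ), t ∈ Set.Icc (0:ℝ) 1 →
      ContinuousOn (fun x => F (Function.update x i t)) C :=
    fun hF i t htI => hF.comp (continuous_id.update i continuous_const).continuousOn fun x hx => hupd x hx i t htI
  have hcu : ∀ (x : Fin N → ℝ) (i : Fin N), Continuous fun s : ℝ => Function.update x i s :=
    fun x i => continuous_const.update i continuous_id
  -- integrands and representations
  obtain ⟨I0, hI0⟩ : ∃ I0 : (Fin N → ℝ) → ℝ, I0 = fun x =>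
      D0 x - (G0 (Function.update x b 1) - G0 (Function.update x b 0)) := ⟨_, rfl⟩
  obtain ⟨I1, hI1⟩ : ∃ I1 : (Fin N → ℝ) → ℝ, I1 = fun x =>
      D1 x - (G1 (Function.update x a 1) - G1 (Function.update x a 0)) := ⟨_, rfl⟩
  have hI0sa : IsSemialgebraicFunOn ℚ C I0 := by
    rw [hI0]
    exact hD0sa.fun_sub ((hface_sa hG0sa b 1 isAlgebraic_one h1I).fun_sub (hface_sa hG0sa b 0 isAlgebraic_zero h0I))
  have hI1sa : IsSemialgebraicFunOn ℚ C I1 := by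
    rw [hI1]
    exact hD1sa.fun_sub ((hface_sa hG1sa a 1 isAlgebraic_one h1I).fun_sub (hface_sa hG1sa a 0 isAlgebraic_zero h0I))
  have hI0c : ContinuousOn I0 C := by
    rw [hI0]; exact hD0c.sub ((hface_c hG0c b 1 h1I).sub (hface_c hG0c b 0 h0I))
  have hI1c : ContinuousOn I1 C := by
    rw [hI1]; exact hD1c.sub ((hface_c hG1c a 1 h1I).sub (hface_c hG1c a 0 h0I))
  obtain ⟨q0, hq0d, hq0i⟩ := exists_cubeRep N I0 hI0sa hI0c
  obtain ⟨q1, hq1d, hq1i⟩ := exists_cubeRep N I1 hI1sa hI1c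
  have hbound : ∀ {F : (Fin N → ℝ) → ℝ}, ContinuousOn F C → ∃ B : ℝ, ∀ x ∈ C, |F x| ≤ B := fun hF => by
    obtain ⟨B, hB⟩ := hCc.exists_bound_of_continuousOn hF
    exact ⟨B, fun x hx => by simpa [Real.norm_eq_abs] using hB x hx⟩
  -- pointwise bookkeeping along the two fibres
  have hu_b : ∀ x s, u (Function.update x b s) = (1 - s) * x a + s * ψ x := by
    intro x s; rw [hu]; simp [Function.update_of_ne hab, hψb]
  have hw_b : ∀ x s, w (Function.update x b s) = (1 - s) + s * ψₐ x := by
    intro x s; rw [hw]; simp [hψₐb]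
  have hfP_b : ∀ x s, f (P (Function.update x b s)) = f (Function.update x a ((1 - s) * x a + s * ψ x)) := by
    intro x s; rw [hP]; simp only [hu_b]; rw [Function.update_comm hba, hfb]
  have hu_a : ∀ x s, u (Function.update x a s) = (1 - x b) * s + x b * ψ (Function.update x a s) := by
    intro x s; rw [hu]; simp [Function.update_of_ne hba]
  have hP_a : ∀ x s, P (Function.update x a s) =
      Function.update x a ((1 - x b) * s + x b * ψ (Function.update x a s)) := by
    intro x s; rw [hP]; simp only [hu_a, Function.update_idem]
  -- assemble
  have hdec : FibStokesDecomposable N (fun x => ∑ j, ((![q0, q1] : Fin 2 → IntegralRep N) j).integrand x) := by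
    refine fibStokesDecomposable_of_elements (M := N) (J := 2) (![b, a] : Fin 2 → Fin N)
      (![G0, G1] : Fin 2 → (Fin N → ℝ) → ℝ) (![D0, D1] : Fin 2 → (Fin N → ℝ) → ℝ)
      (![q0, q1] : Fin 2 → IntegralRep N) ?_ ?_
    · refine Fin.forall_fin_two.mpr ⟨?_, ?_⟩
      · -- element 0, along `b` (the homotopy parameter)
        simp only [Matrix.cons_val_zero]
        refine ⟨hG0sa, hD0sa, hbound hG0c, fun x hx => ?_, fun x hx hxb' => ?_⟩
        · exact hG0c.comp (hcu x b).continuousOn fun s hs => hupd x hx b s hs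
        · have hfun : (fun s : ℝ => G0 (Function.update x b s)) =
              fun s => f (Function.update x a ((1 - s) * x a + s * ψ x)) * ((1 - s) + s * ψₐ x) := by
            funext s; rw [hG0]; simp only [hfP_b, hw_b]
          rw [hfun, hD0]
          simp only
          have hPx : P x = Function.update x a ((1 - x b) * x a + x b * ψ x) := by rw [hP, hu]
          have hl : HasDerivAt (fun s : ℝ => (1 - s) + s * ψₐ x) (ψₐ x - 1) (x b) := by
            have := ((hasDerivAt_id' (x b)).const_sub 1).add ((hasDerivAt_id' (x b)).mul_const (ψₐ x))
            exact this.congr_deriv (by ring)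
          have hin : HasDerivAt (fun s : ℝ => (1 - s) * x a + s * ψ x) (ψ x - x a) (x b) := by
            have := (((hasDerivAt_id' (x b)).const_sub 1).mul_const (x a)).add
              ((hasDerivAt_id' (x b)).mul_const (ψ x))
            exact this.congr_deriv (by ring)
          have hwx : w x = (1 - x b) + x b * ψₐ x := by rw [hw]
          rcases (hmem x hx a).1.eq_or_lt with ha0 | hapos
          · -- `x_a = 0`: `ψ x = 0`, the moved point is frozen
            have hψ0x : ψ x = 0 := hψ0 x hx ha0.symm
            rw [hPx, hψ0x, ← ha0]
            simp only [mul_zero, add_zero, sub_zero, zero_mul, zero_add]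
            exact ((hl.const_mul (f (Function.update x a 0))).congr_deriv (by ring)).congr_of_eventuallyEq
              (Filter.Eventually.of_forall fun s => by simp)
          rcases (hmem x hx a).2.eq_or_lt with ha1 | halt1
          · -- `x_a = 1`: `ψ x = 1`
            have hψ1x : ψ x = 1 := hψ1 x hx ha1
            rw [hPx, hψ1x, ha1]
            have hfun' : (fun s : ℝ => f (Function.update x a ((1 - s) * 1 + s * 1)) * ((1 - s) + s * ψₐ x)) =
                fun s => f (Function.update x a 1) * ((1 - s) + s * ψₐ x) := by
              funext s; ring_nf
            rw [hfun']
            refine (hl.const_mul (f (Function.update x a 1))).congr_deriv ?_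
            ring_nf
          · -- interior: chain rule through the homotopy
            have hxaI : x a ∈ Set.Ioo (0:ℝ) 1 := ⟨hapos, halt1⟩
            have huxI : (1 - x b) * x a + x b * ψ x ∈ Set.Ioo (0:ℝ) 1 := by
              have := huIoo x hx hxaI; rwa [hu] at this
            have hout := hHf x hx _ huxI
            have hcomp : HasDerivAt (fun s : ℝ => f (Function.update x a ((1 - s) * x a + s * ψ x)))
                (fₐ (Function.update x a ((1 - x b) * x a + x b * ψ x)) * (ψ x - x a)) (x b) :=
              HasDerivAt.comp (x b) (h₂ := fun v => f (Function.update x a v)) hout hin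
            rw [hPx, hwx]
            exact (hcomp.mul hl).congr_deriv (by ring)
      · -- element 1, along `a`
        simp only [Matrix.cons_val_one, Matrix.cons_val_zero]
        refine ⟨hG1sa, hD1sa, hbound hG1c, fun x hx => ?_, fun x hx hxa' => ?_⟩
        · exact hG1c.comp (hcu x a).continuousOn fun s hs => hupd x hx a s hs
        · have hxaI : x a ∈ Set.Ioo (0:ℝ) 1 := by simpa using hxa'
          have hfun : (fun s : ℝ => G1 (Function.update x a s)) =
              fun s => -(f (Function.update x a ((1 - x b) * s + x b * ψ (Function.update x a s))) *
                (ψ (Function.update x a s) - s)) := by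
            funext s; rw [hG1]; simp only [hP_a, Function.update_self]
          rw [hfun, hD1]
          simp only
          have hPx : P x = Function.update x a ((1 - x b) * x a + x b * ψ x) := by rw [hP, hu]
          have hwx : w x = (1 - x b) + x b * ψₐ x := by rw [hw]
          have huxI : (1 - x b) * x a + x b * ψ x ∈ Set.Ioo (0:ℝ) 1 := by
            have := huIoo x hx hxaI; rwa [hu] at this
          -- inner map `s ↦ (1 - x_b) s + x_b ψ(x[a ↦ s])`
          have hin : HasDerivAt (fun s : ℝ => (1 - x b) * s + x b * ψ (Function.update x a s))
              ((1 - x b) + x b * ψₐ x) (x a) := by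
            have := ((hasDerivAt_id' (x a)).const_mul (1 - x b)).add ((hψd x hx hxaI).const_mul (x b))
            refine (this.congr_of_eventuallyEq (Filter.Eventually.of_forall fun s => by simp)).congr_deriv ?_
            ring
          have hin0 : (fun s : ℝ => (1 - x b) * s + x b * ψ (Function.update x a s)) (x a) =
              (1 - x b) * x a + x b * ψ x := by simp
          have hout := hHf x hx _ huxI
          rw [← hin0] at hout
          have hcomp : HasDerivAt (fun s : ℝ => f (Function.update x a ((1 - x b) * s + x b * ψ (Function.update x a s))))
              (fₐ (Function.update x a ((fun s : ℝ => (1 - x b) * s + x b * ψ (Function.update x a s)) (x a))) *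
                ((1 - x b) + x b * ψₐ x)) (x a) :=
            HasDerivAt.comp (x a) (h₂ := fun v => f (Function.update x a v)) hout hin
          simp only [Function.update_eq_self] at hcomp
          have hsec : HasDerivAt (fun s : ℝ => ψ (Function.update x a s) - s) (ψₐ x - 1) (x a) :=
            (hψd x hx hxaI).sub (hasDerivAt_id' (x a))
          rw [hPx, hwx]
          refine ((hcomp.mul hsec).neg).congr_deriv ?_
          simp only [Function.update_eq_self]
    · refine Fin.forall_fin_two.mpr ⟨?_, ?_⟩
      · simp only [Matrix.cons_val_zero]
        exact ⟨hq0d, fun x _ => by rw [hq0i, hI0]⟩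
      · simp only [Matrix.cons_val_one, Matrix.cons_val_zero]
        exact ⟨hq1d, fun x _ => by rw [hq1i, hI1]⟩
  -- the pointwise identity
  refine fibStokesDecomposable_congr_off_null N _ _ ∅
    Literature.ModelTheory.ExponentialFields.isSemialgebraic_empty measure_empty (fun x hx _ => ?_) hdec
  have hface0 : G0 (Function.update x b 1) - G0 (Function.update x b 0) = f (Function.update x a (ψ x)) * ψₐ x - f x := by
    rw [hG0]; simp only [hfP_b, hw_b]; simp
  have hface1 : G1 (Function.update x a 1) - G1 (Function.update x a 0) = 0 := by
    rw [hG1]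
    simp only [Function.update_self, hψ1 _ (hupd x hx a 1 h1I) (by simp), hψ0 _ (hupd x hx a 0 h0I) (by simp)]
    ring
  have hsum : D0 x + D1 x = 0 := by rw [hD0, hD1]; simp only; ring
  simp only [Fin.sum_univ_two, Matrix.cons_val_zero, Matrix.cons_val_one, hq0i, hq1i, hI0, hI1, hface0, hface1]
  linarith

/-- **Rule (2) for a fibrewise reparametrisation of one coordinate, in any dimension (lead c5).** On `[0,1]^N` let the
integrand `f` and the new coordinate `ψ` be `ℚ`-semialgebraic and continuous, `C¹` along the coordinate `a` with
`ℚ`-semialgebraic continuous fibre derivatives `fₐ`, `ψₐ` (open fibres), with `ψ = 0` on `{x_a = 0}`, `ψ = 1` on `{x_a = 1}`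
and `0 < ψ < 1` in between. Then the change-of-variables relator `f(x) − f(x[a ↦ ψ(x)]) ψₐ(x)` of the fibrewise map
`Ψ : x ↦ x[a ↦ ψ(x)]` is fibrewise-Stokes decomposable on `[0,1]^N` (two elements on `[0,1]^{N+1}`, transcendence-free,
value-free; `fibStokesDecomposable_reparamCore` with a padded idle coordinate, then un-padding). Together with the
permutations and reflections of rung 12 this derives Kontsevich–Zagier's rule (2) on the cube for every composition of
one-coordinate (triangular) semialgebraic `C¹` reparametrisations and hyperoctahedral symmetries from the fibrewise rule (3).
[cite: KontsevichZagier2001, §1.2 rules (2), (3)] -/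
theorem fibStokesDecomposable_sub_reparam {N : ℕ} (a : Fin N) (f fₐ ψ ψₐ : (Fin N → ℝ) → ℝ)
    (hf : IsSemialgebraicFunOn ℚ (Set.pi Set.univ (fun _ : Fin N => Set.Icc (0:ℝ) 1)) f)
    (hfₐ : IsSemialgebraicFunOn ℚ (Set.pi Set.univ (fun _ : Fin N => Set.Icc (0:ℝ) 1)) fₐ)
    (hψ : IsSemialgebraicFunOn ℚ (Set.pi Set.univ (fun _ : Fin N => Set.Icc (0:ℝ) 1)) ψ)
    (hψₐ : IsSemialgebraicFunOn ℚ (Set.pi Set.univ (fun _ : Fin N => Set.Icc (0:ℝ) 1)) ψₐ)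
    (hfc : ContinuousOn f (Set.pi Set.univ (fun _ : Fin N => Set.Icc (0:ℝ) 1)))
    (hfₐc : ContinuousOn fₐ (Set.pi Set.univ (fun _ : Fin N => Set.Icc (0:ℝ) 1)))
    (hψc : ContinuousOn ψ (Set.pi Set.univ (fun _ : Fin N => Set.Icc (0:ℝ) 1)))
    (hψₐc : ContinuousOn ψₐ (Set.pi Set.univ (fun _ : Fin N => Set.Icc (0:ℝ) 1)))
    (hfd : ∀ x ∈ Set.pi Set.univ (fun _ : Fin N => Set.Icc (0:ℝ) 1), x a ∈ Set.Ioo (0:ℝ) 1 →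
      HasDerivAt (fun s => f (Function.update x a s)) (fₐ x) (x a))
    (hψd : ∀ x ∈ Set.pi Set.univ (fun _ : Fin N => Set.Icc (0:ℝ) 1), x a ∈ Set.Ioo (0:ℝ) 1 →
      HasDerivAt (fun s => ψ (Function.update x a s)) (ψₐ x) (x a))
    (hψ0 : ∀ x ∈ Set.pi Set.univ (fun _ : Fin N => Set.Icc (0:ℝ) 1), x a = 0 → ψ x = 0)
    (hψ1 : ∀ x ∈ Set.pi Set.univ (fun _ : Fin N => Set.Icc (0:ℝ) 1), x a = 1 → ψ x = 1)
    (hψIoo : ∀ x ∈ Set.pi Set.univ (fun _ : Fin N => Set.Icc (0:ℝ) 1), x a ∈ Set.Ioo (0:ℝ) 1 →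
      ψ x ∈ Set.Ioo (0:ℝ) 1) :
    FibStokesDecomposable N (fun x => f x - f (Function.update x a (ψ x)) * ψₐ x) := by
  have hCM : IsSemialgebraic ℚ (Set.pi Set.univ (fun _ : Fin (N + 1) => Set.Icc (0:ℝ) 1)) := by
    rw [← cube_eq_pi]; exact isSemialgebraic_cube
  -- readings along `castSucc` on `[0,1]^{N+1}`; the idle coordinate is `last`
  have hne : ∀ j : Fin N, Fin.castSucc j ≠ Fin.last N := fun j => (Fin.castSucc_lt_last j).ne
  have hmemR : ∀ {y : Fin (N + 1) → ℝ}, y ∈ Set.pi Set.univ (fun _ : Fin (N + 1) => Set.Icc (0:ℝ) 1) →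
      (fun j => y (Fin.castSucc j)) ∈ Set.pi Set.univ (fun _ : Fin N => Set.Icc (0:ℝ) 1) :=
    fun hy => Set.mem_univ_pi.mpr fun j => (Set.mem_univ_pi.mp hy) (Fin.castSucc j)
  have hread : ∀ {F : (Fin N → ℝ) → ℝ}, IsSemialgebraicFunOn ℚ (Set.pi Set.univ (fun _ : Fin N => Set.Icc (0:ℝ) 1)) F →
      IsSemialgebraicFunOn ℚ (Set.pi Set.univ (fun _ : Fin (N + 1) => Set.Icc (0:ℝ) 1))
        (fun y => F (fun j => y (Fin.castSucc j))) :=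
    fun hF => (isSemialgebraicFunOn_comp_coord hF Fin.castSucc).mono (fun y hy => hmemR hy) hCM
  have hπc : Continuous fun y : Fin (N + 1) → ℝ => fun j => y (Fin.castSucc j) :=
    continuous_pi fun j => continuous_apply (Fin.castSucc j)
  have hreadc : ∀ {F : (Fin N → ℝ) → ℝ}, ContinuousOn F (Set.pi Set.univ (fun _ : Fin N => Set.Icc (0:ℝ) 1)) →
      ContinuousOn (fun y => F (fun j => y (Fin.castSucc j))) (Set.pi Set.univ (fun _ : Fin (N + 1) => Set.Icc (0:ℝ) 1)) :=
    fun hF => hF.comp hπc.continuousOn fun y hy => hmemR hy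
  have hcu : ∀ (y : Fin (N + 1) → ℝ) (t : ℝ),
      (fun j => Function.update y (Fin.castSucc a) t (Fin.castSucc j)) =
        Function.update (fun j => y (Fin.castSucc j)) a t := by
    intro y t
    ext j
    rcases eq_or_ne j a with rfl | hja
    · simp
    · rw [Function.update_of_ne ((Fin.castSucc_injective N).ne hja), Function.update_of_ne hja]
  have key := fibStokesDecomposable_reparamCore (Fin.castSucc a) (Fin.last N) (hne a)
    (fun y => f (fun j => y (Fin.castSucc j))) (fun y => fₐ (fun j => y (Fin.castSucc j)))
    (fun y => ψ (fun j => y (Fin.castSucc j))) (fun y => ψₐ (fun j => y (Fin.castSucc j)))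
    (hread hf) (hread hfₐ) (hread hψ) (hread hψₐ) (hreadc hfc) (hreadc hfₐc) (hreadc hψc) (hreadc hψₐc)
    (fun y s => by simp only [Function.update_of_ne (hne _)])
    (fun y s => by simp only [Function.update_of_ne (hne _)])
    (fun y s => by simp only [Function.update_of_ne (hne _)])
    (fun y hy hya => by
      have := hfd _ (hmemR hy) (by simpa using hya)
      simpa only [hcu] using this)
    (fun y hy hya => by
      have := hψd _ (hmemR hy) (by simpa using hya)
      simpa only [hcu] using this)
    (fun y hy hya => hψ0 _ (hmemR hy) (by simpa using hya))
    (fun y hy hya => hψ1 _ (hmemR hy) (by simpa using hya))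
    (fun y hy hya => hψIoo _ (hmemR hy) (by simpa using hya))
  have hle : N ≤ N + 1 := N.le_succ
  refine fibStokesDecomposable_unpad hle _ (fibStokesDecomposable_congr_off_null (N + 1) _ _ ∅
    Literature.ModelTheory.ExponentialFields.isSemialgebraic_empty measure_empty (fun y _ _ => ?_) key)
  have e1 : (fun j => y (Fin.castSucc j)) = fun l => y (Fin.castLE hle l) := rfl
  simp only [hcu, e1]

end Summit.KontsevichZagierPeriods.KontsevichZagierPeriods.Cruxes.StokesGeneration.FibrewiseStokes

end
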